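import Literature.MathematicalPhysics.QuantumFieldTheory.Balaban1983to89.B3Ineq313Pointwise
import Literature.MathematicalPhysics.QuantumFieldTheory.Balaban1983to89.B3Taylor310LocalRemainder

/-!
# `Balaban1983to89.B3Ineq314Local` — T. Bałaban, *(Higgs)₂,₃ quantum fields in a finite volume. III. Renormalization*, Commun. Math.
Phys. **88** (1983) 411–445 [Balaban1983Higgs3], p. 436 [PDF 26]: the step from (3.13) to **(3.14)** — the Hölder supremum of the leg
`φ′` along `Γ_{x,x′}` estimated by the LOCALIZED bound (2.11) of the differentiated propagator `G_{(j″)}` whose second leg sits at `x″`,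
*"and the exponential factor together with another exponential factor in (3.13) give us the estimate (3.14)"* — PROVED in POINTWISE form
(before the localization into cubes), completing p20 g2's `B3Ineq313Pointwise.abs_term312_le` (which carried a GLOBAL Hölder constant)

statement-level skeleton of published theorems with citation tags; proofs where landed; nothing here is a claim about the Yang–Mills mass gap

PDF held: `paper:balaban1983-higgs-2-3-quantum-fields-finite-volume` (journal page = PDF page + 410); p. 436 read on the ×4 render
`run/shared/lean/pub/pub-balaban/b2b-balaban-ref1/pages/1983-cmp88-higgs23-III/1983-cmp88-higgs23-III-p026-x4.png`; (2.11) p. 426 [PDF 16].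

CITATION HEADER (lean-in-tree rule).  Part of the lit-balaban TYPED SKELETON (HOME `run/shared/lean/pub/lit-balaban/`), PHASE 2, seat p20
generation 4.  WHAT IS REPRODUCED: row **B3.Eq3.11-3.17** of `HOME/lit-balaban-r15/ROWS-B3.md` (fold owner r15), sub-display (3.14) (the cell
listed *"the cube-localized estimates (3.13)–(3.14) as printed … not typed"*; (3.13) pointwise = `B3Ineq313Pointwise`, p248293).  Inputs: p20
g2's `B3Taylor310Remainder` (p248129: `remFwd`) and `B3Ineq313Pointwise` (p248293: `term312`, `abs_coeff39_le`, `mul_rpow_mul_exp_le_scale`),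
p20 g4's `B3Taylor310LocalRemainder` (the local remainder bound `norm_remFwd_le_local`, the torus metric `tdist_triangle`).

THE PRINTED TEXT (verbatim, p. 436, after (3.13)).  *"We can estimate the factor ((L^{j₁}η)^{−1}dist(Δ(v),Δ(v′)))^{1+α} by O(1) using half of
the exponential factor with index j₁. If φ′ is a leg of a propagator with an index j″, whose second leg is localized in Δ(v″), then the last
supremum in (3.13) can be estimated by O(1)(L^{j″}η)^{−d+1−α} sup_{x∈Δ(v),x′∈Δ(v′)} exp[−δ₀(L^{j″}η)^{−1}dist(Γ_{x,x′},Δ(v″))], and the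
exponential factor together with another exponential factor in (3.13) give us the estimate (the expression (3.12)) ≦ O(1)Σ_{Δ(v),Δ(v′)}
sup_{x∈Δ(v)}|φ(x)|(L^{j₁}η)^{2d}(L^jη)^{−d}exp[−½δ₀(L^jη)^{−1}dist(Δ(v),Δ(v′))](L^{j′}η)^{−d+2}exp[−½δ₀(L^{j′}η)^{−1}dist(Δ(v),Δ(v′))]
·(L^{j₁}η)^{1+α}(L^{j″}η)^{−d+1−α}exp[−½δ₀(L^{j″}η)^{−1}dist(Δ(v),Δ(v″))] (3.14)"* (with (2.11) p. 426: *"|x₂−x₁|^{−α}|U(B̃(Γ_{x₁,x₂}))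
(D^η_{B̃,μ}G^η_{(j)})(Ω,B̃;x₂,x) − (D^η_{B̃,μ}G^η_{(j)})(Ω,B̃;x₁,x)| ≤ O(1)(L^jη)^{−d+1−α}e^{−δ₁(L^jη)^{−1}dist({x₁,x₂},x)}"*).

WHAT IS PROVED, and how (pointwise in `x″`, the position of the second leg of the propagator `G_{(j″)}`; `|·|` = `η·Site.tdist`, the `ℓ¹`
torus distance, as in the sibling files).
* (companion `B3Taylor310LocalRemainder`, same seat: `tdist_triangle`, and `norm_remFwd_le_local` — the remainder of (3.10) along
  `Γ_{x,x′}` is `≤ 2K·η|x − x′|₁` when the derivative of the leg oscillates by `≤ K` on the `ℓ¹`-ball of radius `|x − x′|₁ + 1` about `x`,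
  i.e. the *"last supremum in (3.13)"* taken along the contour only);
* `norm_remFwd_le_of_leg` — under the (2.11)-type two-point bound on the leg around `x″` (`hleg`: `‖(∂^η_μφ′)(z) − (∂^η_μφ′)(z′)‖ ≤
  C₃(η|z − z′|₁)^α e^{−δ(L^{j″}η)^{−1}η·min(|z − x″|₁,|z′ − x″|₁)}`, `C₃` standing for `O(1)(L^{j″}η)^{−d+1−α}`): `‖R(x,x′)‖ ≤ 8C₃e^{δ/2}·u·u^α·
  e^{+½δu/L^{j″}η}·e^{−½δη|x−x″|₁/L^{j″}η}`, `u = η|x − x′|₁` (triangle inequality `dist(Γ_{x,x′},x″) ≥ |x − x″| − |x − x′| − η`; half of the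
  x″-exponential is kept);
* `exp_split_half_local` — *"the exponential factor together with another exponential factor in (3.13)"*: `e^{−δu/s}e^{−δu/s′}e^{+½δu/s″} ≤
  e^{−½δu/min(s,s′)}·e^{−½δu/s}e^{−½δu/s′}` when `max(s,s′) ≤ s″` (the internal lines are earlier than the external one, `j, j′ ≤ j″`);
* **`abs_term312_le_local`** — (3.14) POINTWISE: `|(3.12)| ≤ 8dC₁C₂C₃Q²e^{δ/2}(2/δ + 8/δ²)·(m·m^α)·Σ_{x,x′}η^{2d}‖φ(x)‖·s^{−d}e^{−½δu/s}·
  s′^{2−d}e^{−½δu/s′}·e^{−½δη|x−x″|₁/s″}`, `m = min(s,s′) = L^{j₁}η`, `s″ = L^{j″}η ≥ max(s,s′)`, `η ≤ s″` — the printed factors of (3.14) with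
  `δ₀ = ½δ`; summing `Σ_{x∈Δ(v),x′∈Δ(v′)}η^{2d} = (L^{j₁}η)^{2d}` and bounding `|x − x″|` below by `dist(Δ(v),Δ(v″))` gives the display.
NOT claimed: the cube sums themselves (row B3.Eq2.13-2.14 / (2.15), seat p19), the kernel bounds (2.10)/(2.11) (rows B3.Eq2.10–2.12), the
reading of the slip in the printed (3.13) (GAPS G-B3-07).  D-0026: theorems only, no `def`, no named fact; standard axioms.
Unit `lit-balaban-p20` (literature-prover-lit-balaban-p20-g4-0), 2026-08-21.
-/

open scoped BigOperators RealInnerProductSpace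

namespace Literature.MathematicalPhysics.QuantumFieldTheory.Balaban1983to89.B3Ineq314Local

open LatticeFieldCalculus B3Sect3ScalarSelfEnergy B3Taylor310Remainder B3Ineq313Pointwise B3Taylor310LocalRemainder

noncomputable section

/-! ## 1. The leg of a propagator whose second end sits at `x″`: the (2.11)-type bound ⇒ the local oscillation -/

section Leg

variable {P : Params} {j : ℕ} {V : Type*} [NormedAddCommGroup V] [NormedSpace ℝ V]

/-- **The last supremum in (3.13) estimated through (2.11)** (p. 436, *"If φ′ is a leg of a propagator with an index j″, whose second leg
is localized in Δ(v″), then the last supremum in (3.13) can be estimated by O(1)(L^{j″}η)^{−d+1−α} sup exp[−δ₀(L^{j″}η)^{−1}dist(Γ_{x,x′},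
Δ(v″))]"*), pointwise: under the two-point bound `‖(∂^η_μφ′)(z) − (∂^η_μφ′)(z′)‖ ≤ C₃(η|z − z′|₁)^α e^{−δ(s″)^{−1}η·min(|z−x″|₁,|z′−x″|₁)}`
(`C₃` for `O(1)(L^{j″}η)^{−d+1−α}`, `s″ = L^{j″}η ≥ η`, `0 ≤ α ≤ 1`) the remainder of (3.10) along `Γ_{x,x′}` satisfies `‖R(x,x′)‖ ≤
8C₃e^{δ/2}·u·u^α·e^{+½δu/s″}·e^{−½δη|x−x″|₁/s″}`, `u = η|x − x′|₁` (every site of the contour and its backward neighbour is within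
`|x − x′|₁ + 1` of `x`, hence at least `|x − x″|₁ − |x − x′|₁ − 1` from `x″`; half of the x″-exponential is kept).
[cite: Balaban1983Higgs3, (3.14) p.436] -/
theorem norm_remFwd_le_of_leg {η α C₃ δ s'' : ℝ} (hη : 0 < η) (hα0 : 0 ≤ α) (hα1 : α ≤ 1) (hC₃ : 0 ≤ C₃) (hδ : 0 < δ)
    (hs'' : 0 < s'') (hηs'' : η ≤ s'') {f : SiteField P j V} (x'' : Site P j)
    (hleg : ∀ (μ : Fin P.d) (z z' : Site P j), ‖pdiff η⁻¹ μ f z - pdiff η⁻¹ μ f z'‖ ≤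
      C₃ * (η * Site.tdist z z') ^ α * Real.exp (-(δ * s''⁻¹ * (η * ((min (Site.tdist z x'') (Site.tdist z' x'') : ℕ) : ℝ)))))
    (x y : Site P j) :
    ‖remFwd η⁻¹ f x y‖ ≤ 8 * C₃ * Real.exp (δ / 2) * ((η * Site.tdist x y) * (η * Site.tdist x y) ^ α) *
      Real.exp (δ / 2 * s''⁻¹ * (η * Site.tdist x y)) * Real.exp (-(δ / 2 * s''⁻¹ * (η * Site.tdist x x''))) := by
  set n : ℕ := Site.tdist x y with hn
  -- the local oscillation on the ball of radius n + 1 about x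
  set K : ℝ := C₃ * (η * (2 * ((n + 1 : ℕ) : ℝ))) ^ α *
    (Real.exp (δ / 2 * s''⁻¹ * (η * ((n + 1 : ℕ) : ℝ))) * Real.exp (-(δ / 2 * s''⁻¹ * (η * Site.tdist x x'')))) with hK
  have hK0 : 0 ≤ K := by positivity
  have hosc : ∀ (μ : Fin P.d) (z z' : Site P j), Site.tdist z x ≤ n + 1 → Site.tdist z' x ≤ n + 1 →
      ‖pdiff η⁻¹ μ f z - pdiff η⁻¹ μ f z'‖ ≤ K := by
    intro μ z z' hz hz'
    refine (hleg μ z z').trans ?_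
    -- |z − z′|₁ ≤ 2(n+1)
    have hzz' : (Site.tdist z z' : ℝ) ≤ 2 * ((n + 1 : ℕ) : ℝ) := by
      have h : Site.tdist z z' ≤ Site.tdist z x + Site.tdist x z' := tdist_triangle z x z'
      rw [tdist_comm x z'] at h
      have h' : Site.tdist z z' ≤ 2 * (n + 1) := by omega
      exact_mod_cast h'
    -- min(|z − x″|, |z′ − x″|) + (n+1) ≥ |x − x″|
    have hmin : (Site.tdist x x'' : ℝ) ≤ ((min (Site.tdist z x'') (Site.tdist z' x'') : ℕ) : ℝ) + ((n + 1 : ℕ) : ℝ) := by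
      have h1 : Site.tdist x x'' ≤ Site.tdist x z + Site.tdist z x'' := tdist_triangle x z x''
      have h2 : Site.tdist x x'' ≤ Site.tdist x z' + Site.tdist z' x'' := tdist_triangle x z' x''
      rw [tdist_comm x z] at h1
      rw [tdist_comm x z'] at h2
      have h3 : Site.tdist x x'' ≤ min (Site.tdist z x'') (Site.tdist z' x'') + (n + 1) := by
        rcases le_total (Site.tdist z x'') (Site.tdist z' x'') with h | h
        · rw [min_eq_left h]; omega
        · rw [min_eq_right h]; omega
      exact_mod_cast h3
    have hA : C₃ * (η * Site.tdist z z') ^ α ≤ C₃ * (η * (2 * ((n + 1 : ℕ) : ℝ))) ^ α :=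
      mul_le_mul_of_nonneg_left (Real.rpow_le_rpow (by positivity) (mul_le_mul_of_nonneg_left hzz' hη.le) hα0) hC₃
    have hB : Real.exp (-(δ * s''⁻¹ * (η * ((min (Site.tdist z x'') (Site.tdist z' x'') : ℕ) : ℝ)))) ≤
        Real.exp (δ / 2 * s''⁻¹ * (η * ((n + 1 : ℕ) : ℝ))) * Real.exp (-(δ / 2 * s''⁻¹ * (η * Site.tdist x x''))) := by
      rw [← Real.exp_add, Real.exp_le_exp]
      have hc : 0 ≤ δ * s''⁻¹ * η := by positivity
      have hm0 : (0 : ℝ) ≤ ((min (Site.tdist z x'') (Site.tdist z' x'') : ℕ) : ℝ) := Nat.cast_nonneg _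
      nlinarith [mul_le_mul_of_nonneg_left hmin hc, mul_nonneg hc hm0]
    calc C₃ * (η * Site.tdist z z') ^ α * Real.exp (-(δ * s''⁻¹ * (η * ((min (Site.tdist z x'') (Site.tdist z' x'') : ℕ) : ℝ))))
        ≤ C₃ * (η * (2 * ((n + 1 : ℕ) : ℝ))) ^ α *
          (Real.exp (δ / 2 * s''⁻¹ * (η * ((n + 1 : ℕ) : ℝ))) * Real.exp (-(δ / 2 * s''⁻¹ * (η * Site.tdist x x'')))) :=
          mul_le_mul hA hB (by positivity) (by positivity)
      _ = K := by rw [hK]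
  have hR := norm_remFwd_le_local (inv_pos.mpr hη) hK0 (R := n + 1) (le_refl _) hosc
  rw [inv_inv] at hR
  refine hR.trans ?_
  -- compare 2K·ηn with the displayed right side
  rcases Nat.eq_zero_or_pos n with h0 | hpos
  · have : (n : ℝ) = 0 := by exact_mod_cast h0
    rw [this, mul_zero, mul_zero, zero_mul, mul_zero, mul_zero, zero_mul, zero_mul]
  have hn1 : ((n + 1 : ℕ) : ℝ) ≤ 2 * (n : ℝ) := by
    have : (1 : ℝ) ≤ n := by exact_mod_cast hpos
    push_cast; linarith
  have hu0 : 0 < η * (n : ℝ) := mul_pos hη (by exact_mod_cast hpos)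
  -- (η·2(n+1))^α ≤ 4·(ηn)^α
  have hpow : (η * (2 * ((n + 1 : ℕ) : ℝ))) ^ α ≤ 4 * (η * n) ^ α := by
    calc (η * (2 * ((n + 1 : ℕ) : ℝ))) ^ α ≤ (4 * (η * n)) ^ α :=
          Real.rpow_le_rpow (by positivity) (by nlinarith [hη.le]) hα0
      _ = 4 ^ α * (η * n) ^ α := Real.mul_rpow (by norm_num) hu0.le
      _ ≤ 4 ^ (1 : ℝ) * (η * n) ^ α :=
          mul_le_mul_of_nonneg_right (Real.rpow_le_rpow_of_exponent_le (by norm_num) hα1) (Real.rpow_nonneg hu0.le _)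
      _ = 4 * (η * n) ^ α := by rw [Real.rpow_one]
  -- e^{½δη(n+1)/s″} ≤ e^{δ/2}·e^{½δηn/s″}
  have hexp : Real.exp (δ / 2 * s''⁻¹ * (η * ((n + 1 : ℕ) : ℝ))) ≤ Real.exp (δ / 2) * Real.exp (δ / 2 * s''⁻¹ * (η * n)) := by
    rw [← Real.exp_add, Real.exp_le_exp]
    have h1 : s''⁻¹ * η ≤ 1 := by rw [inv_mul_le_iff₀ hs'']; simpa using hηs''
    push_cast
    nlinarith [h1, hδ.le]
  have hE0 : 0 ≤ Real.exp (-(δ / 2 * s''⁻¹ * (η * Site.tdist x x''))) := (Real.exp_pos _).le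
  calc 2 * K * (η * (n : ℝ))
      = 2 * C₃ * ((η * (2 * ((n + 1 : ℕ) : ℝ))) ^ α * Real.exp (δ / 2 * s''⁻¹ * (η * ((n + 1 : ℕ) : ℝ)))) * (η * n) *
          Real.exp (-(δ / 2 * s''⁻¹ * (η * Site.tdist x x''))) := by rw [hK]; ring
    _ ≤ 2 * C₃ * ((4 * (η * n) ^ α) * (Real.exp (δ / 2) * Real.exp (δ / 2 * s''⁻¹ * (η * n)))) * (η * n) *
          Real.exp (-(δ / 2 * s''⁻¹ * (η * Site.tdist x x''))) := by
        gcongr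
    _ = 8 * C₃ * Real.exp (δ / 2) * ((η * n) * (η * n) ^ α) *
          Real.exp (δ / 2 * s''⁻¹ * (η * n)) * Real.exp (-(δ / 2 * s''⁻¹ * (η * Site.tdist x x''))) := by ring

end Leg

/-! ## 2. "the exponential factor together with another exponential factor in (3.13)": (3.14) pointwise -/

section Ineq314

variable {P : Params} {j : ℕ} {W : Type*} [NormedAddCommGroup W] [InnerProductSpace ℝ W]

/-- p. 436, *"the exponential factor together with another exponential factor in (3.13)"*: for `max(s,s′) ≤ s″` (the internal lines
`j, j′` earlier than `j″`), `e^{−δu/s}e^{−δu/s′}e^{+½δu/s″} ≤ e^{−½δu/min(s,s′)}·(e^{−½δu/s}e^{−½δu/s′})` — half of the factor with the larger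
index absorbs the growth coming from the localization of the contour. [cite: Balaban1983Higgs3, (3.14) p.436] -/
theorem exp_split_half_local {δ s s' s'' u : ℝ} (hδ : 0 < δ) (hs : 0 < s) (hss : max s s' ≤ s'') (hu : 0 ≤ u) :
    Real.exp (-(δ * s⁻¹ * u)) * Real.exp (-(δ * s'⁻¹ * u)) * Real.exp (δ / 2 * s''⁻¹ * u) ≤
      Real.exp (-(δ / 2 * (min s s')⁻¹ * u)) * (Real.exp (-(δ / 2 * s⁻¹ * u)) * Real.exp (-(δ / 2 * s'⁻¹ * u))) := by
  have hM : 0 < max s s' := lt_max_of_lt_left hs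
  have h1 : s''⁻¹ ≤ (max s s')⁻¹ := inv_anti₀ hM hss
  have hsum : (min s s')⁻¹ + (max s s')⁻¹ = s⁻¹ + s'⁻¹ := by
    rcases le_total s s' with h | h
    · rw [min_eq_left h, max_eq_right h]
    · rw [min_eq_right h, max_eq_left h, add_comm]
  rw [← Real.exp_add, ← Real.exp_add, ← Real.exp_add, ← Real.exp_add, Real.exp_le_exp]
  have hu' : 0 ≤ δ / 2 * u := by positivity
  nlinarith [mul_le_mul_of_nonneg_left h1 hu', hsum]

/-- kernel: the two mechanisms combined, local version — `e^{−δu/s}e^{−δu/s′}e^{½δu/s″}·u·u^α ≤ (2/δ + 8/δ²)·m·m^α·e^{−½δu/s}e^{−½δu/s′}`,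
`m = min(s,s′)`, `max(s,s′) ≤ s″`. [cite: Balaban1983Higgs3, (3.14) p.436] -/
theorem exp_mul_weight_le_local {δ s s' s'' u α : ℝ} (hδ : 0 < δ) (hs : 0 < s) (hs' : 0 < s') (hss : max s s' ≤ s'') (hu : 0 ≤ u)
    (hα0 : 0 ≤ α) (hα1 : α ≤ 1) :
    Real.exp (-(δ * s⁻¹ * u)) * Real.exp (-(δ * s'⁻¹ * u)) * Real.exp (δ / 2 * s''⁻¹ * u) * (u * u ^ α) ≤
      (2 / δ + 8 / δ ^ 2) * (min s s' * (min s s') ^ α) *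
        (Real.exp (-(δ / 2 * s⁻¹ * u)) * Real.exp (-(δ / 2 * s'⁻¹ * u))) := by
  have hm : 0 < min s s' := lt_min hs hs'
  have h1 := exp_split_half_local hδ hs hss hu
  have h2 := mul_rpow_mul_exp_le_scale hu hα0 hα1 (half_pos hδ) hm
  have hconst : 1 / (δ / 2) + 2 / (δ / 2) ^ 2 = 2 / δ + 8 / δ ^ 2 := by
    field_simp; ring
  rw [hconst] at h2
  have huu : 0 ≤ u * u ^ α := mul_nonneg hu (Real.rpow_nonneg hu _)
  calc Real.exp (-(δ * s⁻¹ * u)) * Real.exp (-(δ * s'⁻¹ * u)) * Real.exp (δ / 2 * s''⁻¹ * u) * (u * u ^ α)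
      ≤ Real.exp (-(δ / 2 * (min s s')⁻¹ * u)) * (Real.exp (-(δ / 2 * s⁻¹ * u)) * Real.exp (-(δ / 2 * s'⁻¹ * u)))
          * (u * u ^ α) := mul_le_mul_of_nonneg_right h1 huu
    _ = (u * u ^ α * Real.exp (-(δ / 2 * (min s s')⁻¹ * u)))
          * (Real.exp (-(δ / 2 * s⁻¹ * u)) * Real.exp (-(δ / 2 * s'⁻¹ * u))) := by ring
    _ ≤ ((2 / δ + 8 / δ ^ 2) * (min s s' * (min s s') ^ α))
          * (Real.exp (-(δ / 2 * s⁻¹ * u)) * Real.exp (-(δ / 2 * s'⁻¹ * u))) :=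
        mul_le_mul_of_nonneg_right h2 (by positivity)

/-- kernel: the pairing with the charge matrix: `|φ(x)·q(qR)| ≤ ‖φ(x)‖·Q²·‖R‖` when `‖qw‖ ≤ Q‖w‖`. [folklore] -/
private theorem abs_inner_qq_le {Q : ℝ} (hQ : 0 ≤ Q) (q : W →ₗ[ℝ] W) (hq : ∀ w : W, ‖q w‖ ≤ Q * ‖w‖) (a R : W) :
    |⟪a, q (q R)⟫| ≤ ‖a‖ * (Q ^ 2 * ‖R‖) := by
  calc |⟪a, q (q R)⟫| ≤ ‖a‖ * ‖q (q R)‖ := abs_real_inner_le_norm _ _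
    _ ≤ ‖a‖ * (Q ^ 2 * ‖R‖) := by
        refine mul_le_mul_of_nonneg_left ?_ (norm_nonneg _)
        calc ‖q (q R)‖ ≤ Q * ‖q R‖ := hq _
          _ ≤ Q * (Q * ‖R‖) := mul_le_mul_of_nonneg_left (hq R) hQ
          _ = Q ^ 2 * ‖R‖ := by ring

/-- **(3.14)** p. 436 [PDF 26], POINTWISE form (before the localization into cubes), PROVED: under the (2.10)-type bounds on the two
propagator kernels at the scales `s = L^jη`, `s′ = L^{j′}η` (rate `δ`), `|g|, |g′| ≤ 1`, `‖qw‖ ≤ Q‖w‖`, and — in place of the global Hölder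
hypothesis of `B3Ineq313Pointwise.abs_term312_le` — the LOCALIZED (2.11)-type two-point bound on the leg `φ′` around the position `x″` of
the second leg of its propagator `G_{(j″)}` (`hleg`, `C₃` for `O(1)(L^{j″}η)^{−d+1−α}`, `s″ = L^{j″}η ≥ max(s,s′)`, `η ≤ s″`):
`|(3.12)| ≤ 8dC₁C₂C₃Q²e^{δ/2}(2/δ + 8/δ²)·(m·m^α)·Σ_{x,x′}η^{2d}‖φ(x)‖·s^{−d}e^{−½δ|x−x′|/s}·s′^{2−d}e^{−½δ|x−x′|/s′}·e^{−½δ|x−x″|/s″}`,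
`m = min(s,s′) = L^{j₁}η` — the printed factors `(L^jη)^{−d}e^{−½δ₀…}(L^{j′}η)^{−d+2}e^{−½δ₀…}(L^{j₁}η)^{1+α}(L^{j″}η)^{−d+1−α}e^{−½δ₀…dist(·,Δ(v″))}`
of (3.14) with `δ₀ = δ`. [cite: Balaban1983Higgs3, (3.14) p.436] -/
theorem abs_term312_le_local (η : ℝ) (hη : 0 < η) {α Q C₁ C₂ C₃ δ s s' s'' : ℝ} (hα0 : 0 ≤ α) (hα1 : α ≤ 1) (hQ : 0 ≤ Q)
    (hC₃ : 0 ≤ C₃) (hδ : 0 < δ) (hs : 0 < s) (hs' : 0 < s') (hss : max s s' ≤ s'') (hηs'' : η ≤ s'')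
    (q : W →ₗ[ℝ] W) (hq : ∀ w : W, ‖q w‖ ≤ Q * ‖w‖)
    (Gj Gj' : Kernel P j) (g g' : SiteField P j ℝ) (hg : ∀ x, |g x| ≤ 1) (hg' : ∀ x, |g' x| ≤ 1)
    (hGj : ∀ (μ : Fin P.d) (x x' : Site P j),
      |dKernel η⁻¹ μ Gj x x'| ≤ C₁ * s ^ (-(P.d : ℝ)) * Real.exp (-(δ * s⁻¹ * (η * Site.tdist x x'))))
    (hGj' : ∀ x x' : Site P j,
      |Gj' x x'| ≤ C₂ * s' ^ (2 - (P.d : ℝ)) * Real.exp (-(δ * s'⁻¹ * (η * Site.tdist x x'))))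
    (φ φ' : SiteField P j W) (x'' : Site P j)
    (hleg : ∀ (μ : Fin P.d) (z z' : Site P j), ‖pdiff η⁻¹ μ φ' z - pdiff η⁻¹ μ φ' z'‖ ≤
      C₃ * (η * Site.tdist z z') ^ α * Real.exp (-(δ * s''⁻¹ * (η * ((min (Site.tdist z x'') (Site.tdist z' x'') : ℕ) : ℝ))))) :
    |term312 η q Gj Gj' g g' φ φ'| ≤
      8 * P.d * C₁ * C₂ * C₃ * Q ^ 2 * Real.exp (δ / 2) * (2 / δ + 8 / δ ^ 2) * (min s s' * (min s s') ^ α) *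
        ∑ x : Site P j, ∑ x' : Site P j, η ^ (2 * P.d) *
          (‖φ x‖ * (s ^ (-(P.d : ℝ)) * Real.exp (-(δ / 2 * s⁻¹ * (η * Site.tdist x x'))))
            * (s' ^ (2 - (P.d : ℝ)) * Real.exp (-(δ / 2 * s'⁻¹ * (η * Site.tdist x x'))))
            * Real.exp (-(δ / 2 * s''⁻¹ * (η * Site.tdist x x'')))) := by
  have hs'' : 0 < s'' := lt_of_lt_of_le (lt_max_of_lt_left hs) hss
  have hC₁ : 0 ≤ C₁ := by
    have h := (abs_nonneg _).trans (hGj ⟨0, P.hd⟩ default default)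
    have hpos : 0 < s ^ (-(P.d : ℝ)) * Real.exp (-(δ * s⁻¹ * (η * Site.tdist (default : Site P j) default))) :=
      mul_pos (Real.rpow_pos_of_pos hs _) (Real.exp_pos _)
    rw [mul_assoc] at h
    exact nonneg_of_mul_nonneg_left h hpos
  have hC₂ : 0 ≤ C₂ := by
    have h := (abs_nonneg _).trans (hGj' default default)
    have hpos : 0 < s' ^ (2 - (P.d : ℝ)) * Real.exp (-(δ * s'⁻¹ * (η * Site.tdist (default : Site P j) default))) :=
      mul_pos (Real.rpow_pos_of_pos hs' _) (Real.exp_pos _)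
    rw [mul_assoc] at h
    exact nonneg_of_mul_nonneg_left h hpos
  set K : ℝ := 8 * P.d * C₁ * C₂ * C₃ * Q ^ 2 * Real.exp (δ / 2) * (2 / δ + 8 / δ ^ 2) * (min s s' * (min s s') ^ α) with hK
  have hterm : ∀ x x' : Site P j,
      |η ^ (2 * P.d) * (coeff39 η Gj Gj' g g' x x' * ⟪φ x, q (q (remFwd η⁻¹ φ' x x'))⟫)| ≤
        K * (η ^ (2 * P.d) * (‖φ x‖ * (s ^ (-(P.d : ℝ)) * Real.exp (-(δ / 2 * s⁻¹ * (η * Site.tdist x x'))))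
          * (s' ^ (2 - (P.d : ℝ)) * Real.exp (-(δ / 2 * s'⁻¹ * (η * Site.tdist x x'))))
          * Real.exp (-(δ / 2 * s''⁻¹ * (η * Site.tdist x x''))))) := by
    intro x x'
    set u : ℝ := η * Site.tdist x x' with hu
    have hu0 : 0 ≤ u := mul_nonneg hη.le (Nat.cast_nonneg _)
    set E : ℝ := Real.exp (-(δ / 2 * s''⁻¹ * (η * Site.tdist x x''))) with hE
    have hE0 : 0 ≤ E := (Real.exp_pos _).le
    -- the remainder through the localized (2.11)-type bound
    have hR : ‖remFwd η⁻¹ φ' x x'‖ ≤ 8 * C₃ * Real.exp (δ / 2) * (u * u ^ α) * Real.exp (δ / 2 * s''⁻¹ * u) * E :=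
      norm_remFwd_le_of_leg hη hα0 hα1 hC₃ hδ hs'' hηs'' x'' hleg x x'
    have hinner : |⟪φ x, q (q (remFwd η⁻¹ φ' x x'))⟫| ≤
        ‖φ x‖ * (Q ^ 2 * (8 * C₃ * Real.exp (δ / 2) * (u * u ^ α) * Real.exp (δ / 2 * s''⁻¹ * u) * E)) :=
      (abs_inner_qq_le hQ q hq _ _).trans
        (mul_le_mul_of_nonneg_left (mul_le_mul_of_nonneg_left hR (sq_nonneg _)) (norm_nonneg _))
    have hcoeff := abs_coeff39_le hg hg' hGj hGj' x x'
    have hA : 0 ≤ (P.d : ℝ) * (C₁ * s ^ (-(P.d : ℝ)) * Real.exp (-(δ * s⁻¹ * u))) := by positivity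
    have hB : 0 ≤ C₂ * s' ^ (2 - (P.d : ℝ)) * Real.exp (-(δ * s'⁻¹ * u)) := by positivity
    have hweight := exp_mul_weight_le_local hδ hs hs' hss hu0 hα0 hα1
    have hX : 0 ≤ η ^ (2 * P.d) * (P.d * C₁ * s ^ (-(P.d : ℝ)) * (C₂ * s' ^ (2 - (P.d : ℝ))) *
        (‖φ x‖ * Q ^ 2 * (8 * C₃ * Real.exp (δ / 2)) * E)) := by positivity
    calc |η ^ (2 * P.d) * (coeff39 η Gj Gj' g g' x x' * ⟪φ x, q (q (remFwd η⁻¹ φ' x x'))⟫)|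
        = η ^ (2 * P.d) * (|coeff39 η Gj Gj' g g' x x'| * |⟪φ x, q (q (remFwd η⁻¹ φ' x x'))⟫|) := by
          rw [abs_mul, abs_mul, abs_of_nonneg (by positivity : (0:ℝ) ≤ η ^ (2 * P.d))]
      _ ≤ η ^ (2 * P.d) * (((P.d * (C₁ * s ^ (-(P.d : ℝ)) * Real.exp (-(δ * s⁻¹ * u)))) *
            (C₂ * s' ^ (2 - (P.d : ℝ)) * Real.exp (-(δ * s'⁻¹ * u)))) *
            (‖φ x‖ * (Q ^ 2 * (8 * C₃ * Real.exp (δ / 2) * (u * u ^ α) * Real.exp (δ / 2 * s''⁻¹ * u) * E)))) := by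
          refine mul_le_mul_of_nonneg_left ?_ (by positivity)
          exact mul_le_mul hcoeff hinner (abs_nonneg _) (mul_nonneg hA hB)
      _ = η ^ (2 * P.d) * (P.d * C₁ * s ^ (-(P.d : ℝ)) * (C₂ * s' ^ (2 - (P.d : ℝ))) *
            (‖φ x‖ * Q ^ 2 * (8 * C₃ * Real.exp (δ / 2)) * E))
            * (Real.exp (-(δ * s⁻¹ * u)) * Real.exp (-(δ * s'⁻¹ * u)) * Real.exp (δ / 2 * s''⁻¹ * u) * (u * u ^ α)) := by ring
      _ ≤ η ^ (2 * P.d) * (P.d * C₁ * s ^ (-(P.d : ℝ)) * (C₂ * s' ^ (2 - (P.d : ℝ))) *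
            (‖φ x‖ * Q ^ 2 * (8 * C₃ * Real.exp (δ / 2)) * E))
            * ((2 / δ + 8 / δ ^ 2) * (min s s' * (min s s') ^ α) *
              (Real.exp (-(δ / 2 * s⁻¹ * u)) * Real.exp (-(δ / 2 * s'⁻¹ * u)))) :=
          mul_le_mul_of_nonneg_left hweight hX
      _ = K * (η ^ (2 * P.d) * (‖φ x‖ * (s ^ (-(P.d : ℝ)) * Real.exp (-(δ / 2 * s⁻¹ * u)))
          * (s' ^ (2 - (P.d : ℝ)) * Real.exp (-(δ / 2 * s'⁻¹ * u))) * E)) := by rw [hK]; ring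
  unfold term312
  calc |∑ x : Site P j, ∑ x' : Site P j, η ^ (2 * P.d) *
          (coeff39 η Gj Gj' g g' x x' * ⟪φ x, q (q (remFwd η⁻¹ φ' x x'))⟫)|
      ≤ ∑ x : Site P j, |∑ x' : Site P j, η ^ (2 * P.d) *
          (coeff39 η Gj Gj' g g' x x' * ⟪φ x, q (q (remFwd η⁻¹ φ' x x'))⟫)| := Finset.abs_sum_le_sum_abs _ _
    _ ≤ ∑ x : Site P j, ∑ x' : Site P j, |η ^ (2 * P.d) *
          (coeff39 η Gj Gj' g g' x x' * ⟪φ x, q (q (remFwd η⁻¹ φ' x x'))⟫)| :=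
        Finset.sum_le_sum fun x _ => Finset.abs_sum_le_sum_abs _ _
    _ ≤ ∑ x : Site P j, ∑ x' : Site P j, K * (η ^ (2 * P.d) * (‖φ x‖
          * (s ^ (-(P.d : ℝ)) * Real.exp (-(δ / 2 * s⁻¹ * (η * Site.tdist x x'))))
          * (s' ^ (2 - (P.d : ℝ)) * Real.exp (-(δ / 2 * s'⁻¹ * (η * Site.tdist x x'))))
          * Real.exp (-(δ / 2 * s''⁻¹ * (η * Site.tdist x x''))))) :=
        Finset.sum_le_sum fun x _ => Finset.sum_le_sum fun x' _ => hterm x x'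
    _ = K * ∑ x : Site P j, ∑ x' : Site P j, η ^ (2 * P.d) * (‖φ x‖
          * (s ^ (-(P.d : ℝ)) * Real.exp (-(δ / 2 * s⁻¹ * (η * Site.tdist x x'))))
          * (s' ^ (2 - (P.d : ℝ)) * Real.exp (-(δ / 2 * s'⁻¹ * (η * Site.tdist x x'))))
          * Real.exp (-(δ / 2 * s''⁻¹ * (η * Site.tdist x x'')))) := by
        rw [Finset.mul_sum]
        exact Finset.sum_congr rfl fun x _ => by rw [Finset.mul_sum]

end Ineq314

end

end Literature.MathematicalPhysics.QuantumFieldTheory.Balaban1983to89.B3Ineq314Local
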